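import Summits.CriticalPhenomena.PercolationContinuityZ3.Theorems.PercNearOneGluingNoHeavyQuantDepthTwoRows
import Summits.CriticalPhenomena.PercolationContinuityZ3.Theorems.PercNearOneGluingNoHeavyQuantDepthOneRows
import Summits.CriticalPhenomena.PercolationContinuityZ3.Theorems.PercNearOneGluingNoHeavyQuantTLBClosure
import Summits.CriticalPhenomena.PercolationContinuityZ3.Theorems.PercNearOneGluingNoHeavyQuantGateMoveBlobGeneralWitness
import HarnessLib

/-!
# QUANT lane R8, light half: DEC IS NOT OF FINITE DEPTH 2 — an explicit law satisfying every two-layer bound (`LawDec.TLB`), every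
# top-low-capacity row (`LawDec.TLC`) and every two-threshold staircase row (`LawDec.TLC2`) that is NOT DEC (census-2 g66)

builds on p205010 (kernel theorem, internal audit signed; external expert review pending)

Support file (`--supports stmt-CriticalPhenomena-4575`), QUANT lane seat prim-quant-census-2 (gen 66), rung R8 of
`run/shared/lean/prim/quant/LADDER.md`.  Theorems only (one witness law `LawDec.p2w` and its price vectors as `def`s), standard axioms, default
heartbeats, no sorries.  Census memo: `run/shared/lean/prim/quant/prim-quant-census-2-g66/DEPTH-PROBE-G66.md` §1, §3.

WHY.  The graded-closure programme for the light half (`y < 1/2`; lead g37 V364, census-2 g64 `…QuantDepthOneRows` / `…QuantDepthTwoRows`) asks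
whether a FINITE-DEPTH row family — depth 0 = `TLB`, depth ≤ 1 = `TLC`, depth ≤ 2 = `TLC2` — can be an invariant closed under gated convolution.  Depth 0
and depth 1 are not (`not_tlbGateConvClosed`, M = 9; `not_tlcGateConvClosed`, M = 14), and the MECHANISM of both deaths is the same: a factor satisfying every
depth-≤ k row violates a depth-(k+1) row, which a relay partner shifts into a product depth-k row.  The first question for k = 2 is therefore whether,
on `{0..M}` with top-affordability and the mean, the depth-≤ 2 rows already imply ALL of DEC.  This file proves in the kernel that they do NOT:

* **`LawDec.p2w`** = `{1: 4977259/7697490, 2: 9361/1282915, 3: 6549/513166, 10: 9737/513166, 17: 483955/1539498}` (≈ {1: .6466, 2: .0073, 3: .0128,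
  10: .0190, 17: .3144}) on `{0..17}`, floor `y = 1/3` (`u = 1/2`), mean `T = 187/30` (top-affordable: `17/3 ≤ 187/30`);
* `tlb_p2w`, `tlc_p2w`, `tlc2_p2w`: it satisfies `TLB (1/2) T 17`, `TLC (1/3) T 17`, `TLC2 (1/3) T 17` — every depth-≤ 2 row at every layer (the two-layer
  bound at `d = 3` and the TLC2 row `(j′, i″, i′) = (10.., 1, 2)` at its kink hold with equality);
* **`not_decAt_p2w : ¬ DECAt (1/3) 10 17 p2w`** — by weak duality (`dual_le_of_decAtT`) with the THREE-LEVEL staircase price `α = (1/2, 1/2, 1391/5842,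
  11/127)` on the lows `0..3` and `β₁₀ = 143/254` on the only mass-carrying mid (giants `h ≥ 11` priced `1`; the massless mids `4..9` priced `100`):
  the mid `10` serves the lows `1, 2, 3` at usages `127/143, 107/253, 2/13`, so one mid generates TWO kinks — a two-block staircase can price only two of
  the three lows correctly; the dual value is `72039/65172082 > 0`;
* **`depthTwo_ne_dec`**: the packaged existential (floor `< 1/2`, probability law, top-affordable, mean, `TLB ∧ TLC ∧ TLC2`, `¬ DECAt`).

CENSUS CONTEXT (exact, memo §3): such laws exist from `M = 12–13` at `y = 0.49`, `M = 14` at `y = 0.45 / 0.40`, `M = 16` at `0.35`, `M = 17` at `1/3` (this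
file), `M = 21` at `0.30`, and at gates `q < 1`; depth-3-but-not-DEC laws from `M ≤ 24`.  CONSEQUENCE: no finite-depth row class COINCIDES with DEC, so a
finite-depth class can be closed under gated convolution only by NON-TRANSMISSION (no partner reads the ≥ 3-level defect through product rows of lower
depth) — which is exactly what is now at stake for D2 (the depth-2 class contains `TLB`, so its closure would still give `FarTreeRow`; no closure counterexample
is known up to M ≈ 30, memo §3b; D0 / D1 transmitted at M = 9 / 14).  HONEST STATUS: a structural negative result about candidate invariants; nothing in
the lane's RATE class log\* or honest sentence (`run/shared/lean/prim/quant/README.md`) changes; `SingleGateConvClosed` and the closure of the depth-2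
class are OPEN (first exact adversaries beyond M = 14: memo §3b, §4).

[this work]; the row families: prim-quant-lead g37 (`TLB`), prim-quant-census-2 g63/g64 (`TLC`, `TLC2`); flows, usage and weak duality: prim-quant-stmt g22
(`…QuantLawDecFlows`); `usage_mid_eq` / `usage_giant_eq` / `heavy_le_usage`: this lane.  Nothing here is cited as a published result.  The gluing rows served
[cite: KozmaNitzan2024, Conjecture 3 (p. 15)]; product measure [cite: Grimmett1999, §1.3 p. 10].
-/

noncomputable section

namespace Summit.CriticalPhenomena.PercolationContinuityZ3.Theorems

namespace Quant

open Finset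

namespace LawDec

/-! ### The witness law and its elementary facts -/

/-- **the witness law** `{1: 4977259/7697490, 2: 9361/1282915, 3: 6549/513166, 10: 9737/513166, 17: 483955/1539498}` on `{0..17}` (a vertex of the depth-2
polytope at `y = 1/3`, `T = 187/30`, found by census-2 g66's probe_k; kit j219109). [this work] -/
def p2w (h : ℕ) : ℝ :=
  if h = 1 then 4977259 / 7697490 else if h = 2 then 9361 / 1282915 else if h = 3 then 6549 / 513166 else if h = 10 then 9737 / 513166 else if h = 17 then 483955 / 1539498 else 0

/-- `p2w ≥ 0`. [this work] -/
theorem p2w_nonneg (h : ℕ) : 0 ≤ p2w h := by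
  simp only [p2w]; split_ifs <;> norm_num

/-- `p2w` vanishes above `17`. [this work] -/
theorem p2w_zero_above (h : ℕ) (hh : 17 < h) : p2w h = 0 := by
  simp only [p2w]; rw [if_neg (by omega), if_neg (by omega), if_neg (by omega), if_neg (by omega), if_neg (by omega)]

/-- `p2w` has mass `1`. [this work] -/
theorem p2w_sum : ∑ h ∈ Finset.range (17 + 1), p2w h = 1 := by
  simp only [p2w, Finset.sum_range_succ, Finset.sum_range_zero]; norm_num

/-- `p2w` has mean `187/30`. [this work] -/
theorem p2w_mean : ∑ h ∈ Finset.range (17 + 1), (h : ℝ) * p2w h = 187 / 30 := by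
  simp only [p2w, Finset.sum_range_succ, Finset.sum_range_zero]; norm_num

/-- `p2w` is top-affordable at floor `1/3`: `(1/3)·17 ≤ 187/30`. [this work] -/
theorem p2w_TA : (1 / 3 : ℝ) * ((17 : ℕ) : ℝ) ≤ ∑ h ∈ Finset.range (17 + 1), (h : ℝ) * p2w h := by
  rw [p2w_mean]; norm_num

/-! ### The four usages of the mid `10` and the giant usage -/

/-- usage of the mid `10` for the low `0` at `(1/3, 187/30)`: `187 / 113`. [this work] -/
theorem p2w_usage10_0 (j : ℕ) (hj : 10 ≤ j) : usage (1 / 3 : ℝ) (187 / 30) j 0 10 = 187 / 113 := by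
  rw [usage_mid_eq (1 / 3 : ℝ) (187 / 30) j 0 10 (by norm_num) (by norm_num) hj (by norm_num) (by norm_num)]
  norm_num [max_eq_left, max_eq_right, le_refl]

/-- usage of the mid `10` for the low `1` at `(1/3, 187/30)`: `127 / 143`. [this work] -/
theorem p2w_usage10_1 (j : ℕ) (hj : 10 ≤ j) : usage (1 / 3 : ℝ) (187 / 30) j 1 10 = 127 / 143 := by
  rw [usage_mid_eq (1 / 3 : ℝ) (187 / 30) j 1 10 (by norm_num) (by norm_num) hj (by norm_num) (by norm_num)]
  norm_num [max_eq_left, max_eq_right, le_refl]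

/-- usage of the mid `10` for the low `2` at `(1/3, 187/30)`: `107 / 253`. [this work] -/
theorem p2w_usage10_2 (j : ℕ) (hj : 10 ≤ j) : usage (1 / 3 : ℝ) (187 / 30) j 2 10 = 107 / 253 := by
  rw [usage_mid_eq (1 / 3 : ℝ) (187 / 30) j 2 10 (by norm_num) (by norm_num) hj (by norm_num) (by norm_num)]
  norm_num [max_eq_left, max_eq_right, le_refl]

/-- usage of the mid `10` for the low `3` at `(1/3, 187/30)`: `2 / 13`. [this work] -/
theorem p2w_usage10_3 (j : ℕ) (hj : 10 ≤ j) : usage (1 / 3 : ℝ) (187 / 30) j 3 10 = 2 / 13 := by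
  rw [usage_mid_eq (1 / 3 : ℝ) (187 / 30) j 3 10 (by norm_num) (by norm_num) hj (by norm_num) (by norm_num)]
  norm_num [max_eq_left, max_eq_right, le_refl]

/-- giant usage at floor `1/3` is `1/2`. [this work] -/
theorem p2w_usage_giant (j l h : ℕ) (hh : j + 1 ≤ h) : usage (1 / 3 : ℝ) (187 / 30) j l h = 1 / 2 := by
  rw [usage_giant_eq (1 / 3 : ℝ) (187 / 30) j l h hh]; norm_num

/-! ### Depth 0: the two-layer bounds -/

/-- **`p2w` satisfies every two-layer bound** at rate `1/2`, target `187/30` (`d ≤ 3`; `d = 3` with equality). [this work] -/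
theorem tlb_p2w : TLB (1 / 2 : ℝ) (187 / 30) 17 p2w := by
  intro d hd
  have hd3 : d ≤ 3 := by
    by_contra hne
    have : (4 : ℝ) ≤ d := by exact_mod_cast (by omega : 4 ≤ d)
    linarith
  interval_cases d <;> simp only [p2w, Finset.sum_range_succ, Finset.sum_range_zero] <;> norm_num

/-! ### Depth 1: the top-low-capacity rows (threshold by threshold; the only mass-carrying mid is `10`) -/

/-- the TLC rows of `p2w` with threshold `i′ = 0`. [this work] -/
theorem tlc_p2w_rows0 (j : ℕ) (hj : j < 17) (hi' : 0 ≤ j) :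
    (1 / 3 : ℝ) / (1 - 1 / 3) * ∑ l ∈ Finset.range (0 + 1), p2w l
      ≤ ∑ h ∈ Finset.range (17 + 1), (if j + 1 ≤ h then p2w h else 0)
        + (1 / 3 : ℝ) / (1 - 1 / 3) * ∑ h ∈ Finset.range (17 + 1),
            (if h ≤ j ∧ (187 / 30 : ℝ) < ((0 : ℕ) : ℝ) + h then p2w h / usage (1 / 3) (187 / 30) j 0 h else 0) := by
  interval_cases j <;> norm_num [Finset.sum_range_succ, p2w, p2w_usage10_0, p2w_usage10_1, p2w_usage10_2, p2w_usage10_3]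

/-- the TLC rows of `p2w` with threshold `i′ = 1`. [this work] -/
theorem tlc_p2w_rows1 (j : ℕ) (hj : j < 17) (hi' : 1 ≤ j) :
    (1 / 3 : ℝ) / (1 - 1 / 3) * ∑ l ∈ Finset.range (1 + 1), p2w l
      ≤ ∑ h ∈ Finset.range (17 + 1), (if j + 1 ≤ h then p2w h else 0)
        + (1 / 3 : ℝ) / (1 - 1 / 3) * ∑ h ∈ Finset.range (17 + 1),
            (if h ≤ j ∧ (187 / 30 : ℝ) < ((1 : ℕ) : ℝ) + h then p2w h / usage (1 / 3) (187 / 30) j 1 h else 0) := by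
  interval_cases j <;> norm_num [Finset.sum_range_succ, p2w, p2w_usage10_0, p2w_usage10_1, p2w_usage10_2, p2w_usage10_3]

/-- the TLC rows of `p2w` with threshold `i′ = 2`. [this work] -/
theorem tlc_p2w_rows2 (j : ℕ) (hj : j < 17) (hi' : 2 ≤ j) :
    (1 / 3 : ℝ) / (1 - 1 / 3) * ∑ l ∈ Finset.range (2 + 1), p2w l
      ≤ ∑ h ∈ Finset.range (17 + 1), (if j + 1 ≤ h then p2w h else 0)
        + (1 / 3 : ℝ) / (1 - 1 / 3) * ∑ h ∈ Finset.range (17 + 1),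
            (if h ≤ j ∧ (187 / 30 : ℝ) < ((2 : ℕ) : ℝ) + h then p2w h / usage (1 / 3) (187 / 30) j 2 h else 0) := by
  interval_cases j <;> norm_num [Finset.sum_range_succ, p2w, p2w_usage10_0, p2w_usage10_1, p2w_usage10_2, p2w_usage10_3]

/-- the TLC rows of `p2w` with threshold `i′ = 3`. [this work] -/
theorem tlc_p2w_rows3 (j : ℕ) (hj : j < 17) (hi' : 3 ≤ j) :
    (1 / 3 : ℝ) / (1 - 1 / 3) * ∑ l ∈ Finset.range (3 + 1), p2w l
      ≤ ∑ h ∈ Finset.range (17 + 1), (if j + 1 ≤ h then p2w h else 0)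
        + (1 / 3 : ℝ) / (1 - 1 / 3) * ∑ h ∈ Finset.range (17 + 1),
            (if h ≤ j ∧ (187 / 30 : ℝ) < ((3 : ℕ) : ℝ) + h then p2w h / usage (1 / 3) (187 / 30) j 3 h else 0) := by
  interval_cases j <;> norm_num [Finset.sum_range_succ, p2w, p2w_usage10_0, p2w_usage10_1, p2w_usage10_2, p2w_usage10_3]

/-- **`p2w` satisfies every top-low-capacity row** (`TLC` at floor `1/3`, target `187/30`). [this work] -/
theorem tlc_p2w : TLC (1 / 3 : ℝ) (187 / 30) 17 p2w := by
  intro j i' hj hi' hlow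
  have hi3 : i' ≤ 3 := by
    by_contra hne
    have : (4 : ℝ) ≤ i' := by exact_mod_cast (by omega : 4 ≤ i')
    linarith
  interval_cases i'
  · exact tlc_p2w_rows0 j hj hi'
  · exact tlc_p2w_rows1 j hj hi'
  · exact tlc_p2w_rows2 j hj hi'
  · exact tlc_p2w_rows3 j hj hi'

/-! ### Depth 2: the two-threshold rows.  `cap2 = max(Fst, Snd)`; a row follows from its `Fst`-version (θ-free right side) or its `Snd`-version (linear in θ) -/

/-- the first (`θ`-free) branch of `LawDec.cap2`. [this work] -/
def cap2Fst (x T : ℝ) (j' i'' h : ℕ) : ℝ := if T < (i'' : ℝ) + h then 1 / usage x T j' i'' h else 0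

/-- the second (`θ`-linear) branch of `LawDec.cap2`. [this work] -/
def cap2Snd (x T : ℝ) (j' i' h : ℕ) (θ : ℝ) : ℝ := if T < (i' : ℝ) + h then θ / usage x T j' i' h else 0

/-- `cap2Fst ≤ cap2`. [this work] -/
theorem cap2Fst_le_cap2 (x T : ℝ) (j' i'' i' h : ℕ) (θ : ℝ) : cap2Fst x T j' i'' h ≤ cap2 x T j' i'' i' h θ := by
  unfold cap2Fst cap2; exact le_max_left _ _

/-- `cap2Snd ≤ cap2`. [this work] -/
theorem cap2Snd_le_cap2 (x T : ℝ) (j' i'' i' h : ℕ) (θ : ℝ) : cap2Snd x T j' i' h θ ≤ cap2 x T j' i'' i' h θ := by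
  unfold cap2Snd cap2; exact le_max_right _ _

/-- left side of the TLC2 row `(·, i″, i′, θ)` of `p2w` at floor `1/3`. [this work] -/
def p2wL (i'' i' : ℕ) (θ : ℝ) : ℝ :=
  (1 / 3 : ℝ) / (1 - 1 / 3) * (∑ l ∈ Finset.range (i'' + 1), p2w l + θ * ∑ l ∈ Finset.Ico (i'' + 1) (i' + 1), p2w l)

/-- right side of a layer-`j′` row of `p2w` at floor `1/3` with mid coefficients `c`. [this work] -/
def p2wR (j' : ℕ) (c : ℕ → ℝ) : ℝ :=
  ∑ h ∈ Finset.range (17 + 1), (if j' + 1 ≤ h then p2w h else 0)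
    + (1 / 3 : ℝ) / (1 - 1 / 3) * ∑ h ∈ Finset.range (17 + 1), (if h ≤ j' then p2w h * c h else 0)

/-- monotonicity of `p2wR` in the coefficients (the law is nonnegative). [this work] -/
theorem p2wR_mono (j' : ℕ) (c c' : ℕ → ℝ) (hcc : ∀ h, c h ≤ c' h) : p2wR j' c ≤ p2wR j' c' := by
  unfold p2wR
  have hs : ∑ h ∈ Finset.range (17 + 1), (if h ≤ j' then p2w h * c h else 0)
      ≤ ∑ h ∈ Finset.range (17 + 1), (if h ≤ j' then p2w h * c' h else 0) := by
    refine Finset.sum_le_sum fun h _ => ?_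
    split_ifs
    · exact mul_le_mul_of_nonneg_left (hcc h) (p2w_nonneg h)
    · exact le_rfl
  have hx : (0 : ℝ) ≤ (1 / 3 : ℝ) / (1 - 1 / 3) := by norm_num
  have hm := mul_le_mul_of_nonneg_left hs hx
  linarith

set_option maxHeartbeats 8000000 in
/-- TLC2 rows `(j′, 0, 1)` of `p2w`, `Fst`-branch: valid for `0 ≤ θ ≤ 14351 / 26741` (the kink `usage(1,10)/usage(0,10)`). [this work] -/
theorem tlc2_p2w_A_01 (j' : ℕ) (hj : j' < 17) (hi' : 1 ≤ j') (θ : ℝ) (_hθ0 : 0 ≤ θ) (_hθ : θ ≤ 14351 / 26741) :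
    p2wL 0 1 θ ≤ p2wR j' (cap2Fst (1 / 3) (187 / 30) j' 0) := by
  unfold p2wL p2wR
  interval_cases j' <;> norm_num [Finset.sum_range_succ, Finset.sum_Ico_eq_sum_range, p2w, cap2Fst, p2w_usage10_0, p2w_usage10_1, p2w_usage10_2, p2w_usage10_3] <;> linarith [_hθ0, _hθ]

set_option maxHeartbeats 8000000 in
/-- TLC2 rows `(j′, 0, 1)` of `p2w`, `Snd`-branch: valid for `14351 / 26741 ≤ θ ≤ 1`. [this work] -/
theorem tlc2_p2w_B_01 (j' : ℕ) (hj : j' < 17) (hi' : 1 ≤ j') (θ : ℝ) (_hθ : 14351 / 26741 ≤ θ) (_hθ1 : θ ≤ 1) :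
    p2wL 0 1 θ ≤ p2wR j' (fun h => cap2Snd (1 / 3) (187 / 30) j' 1 h θ) := by
  unfold p2wL p2wR
  interval_cases j' <;> norm_num [Finset.sum_range_succ, Finset.sum_Ico_eq_sum_range, p2w, cap2Snd, p2w_usage10_0, p2w_usage10_1, p2w_usage10_2, p2w_usage10_3] <;> linarith [_hθ, _hθ1]

set_option maxHeartbeats 8000000 in
/-- TLC2 rows `(j′, 0, 2)` of `p2w`, `Fst`-branch: valid for `0 ≤ θ ≤ 12091 / 47311` (the kink `usage(2,10)/usage(0,10)`). [this work] -/
theorem tlc2_p2w_A_02 (j' : ℕ) (hj : j' < 17) (hi' : 2 ≤ j') (θ : ℝ) (_hθ0 : 0 ≤ θ) (_hθ : θ ≤ 12091 / 47311) :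
    p2wL 0 2 θ ≤ p2wR j' (cap2Fst (1 / 3) (187 / 30) j' 0) := by
  unfold p2wL p2wR
  interval_cases j' <;> norm_num [Finset.sum_range_succ, Finset.sum_Ico_eq_sum_range, p2w, cap2Fst, p2w_usage10_0, p2w_usage10_1, p2w_usage10_2, p2w_usage10_3] <;> linarith [_hθ0, _hθ]

set_option maxHeartbeats 8000000 in
/-- TLC2 rows `(j′, 0, 2)` of `p2w`, `Snd`-branch: valid for `12091 / 47311 ≤ θ ≤ 1`. [this work] -/
theorem tlc2_p2w_B_02 (j' : ℕ) (hj : j' < 17) (hi' : 2 ≤ j') (θ : ℝ) (_hθ : 12091 / 47311 ≤ θ) (_hθ1 : θ ≤ 1) :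
    p2wL 0 2 θ ≤ p2wR j' (fun h => cap2Snd (1 / 3) (187 / 30) j' 2 h θ) := by
  unfold p2wL p2wR
  interval_cases j' <;> norm_num [Finset.sum_range_succ, Finset.sum_Ico_eq_sum_range, p2w, cap2Snd, p2w_usage10_0, p2w_usage10_1, p2w_usage10_2, p2w_usage10_3] <;> linarith [_hθ, _hθ1]

set_option maxHeartbeats 8000000 in
/-- TLC2 rows `(j′, 0, 3)` of `p2w`, `Fst`-branch: valid for `0 ≤ θ ≤ 226 / 2431` (the kink `usage(3,10)/usage(0,10)`). [this work] -/
theorem tlc2_p2w_A_03 (j' : ℕ) (hj : j' < 17) (hi' : 3 ≤ j') (θ : ℝ) (_hθ0 : 0 ≤ θ) (_hθ : θ ≤ 226 / 2431) :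
    p2wL 0 3 θ ≤ p2wR j' (cap2Fst (1 / 3) (187 / 30) j' 0) := by
  unfold p2wL p2wR
  interval_cases j' <;> norm_num [Finset.sum_range_succ, Finset.sum_Ico_eq_sum_range, p2w, cap2Fst, p2w_usage10_0, p2w_usage10_1, p2w_usage10_2, p2w_usage10_3] <;> linarith [_hθ0, _hθ]

set_option maxHeartbeats 8000000 in
/-- TLC2 rows `(j′, 0, 3)` of `p2w`, `Snd`-branch: valid for `226 / 2431 ≤ θ ≤ 1`. [this work] -/
theorem tlc2_p2w_B_03 (j' : ℕ) (hj : j' < 17) (hi' : 3 ≤ j') (θ : ℝ) (_hθ : 226 / 2431 ≤ θ) (_hθ1 : θ ≤ 1) :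
    p2wL 0 3 θ ≤ p2wR j' (fun h => cap2Snd (1 / 3) (187 / 30) j' 3 h θ) := by
  unfold p2wL p2wR
  interval_cases j' <;> norm_num [Finset.sum_range_succ, Finset.sum_Ico_eq_sum_range, p2w, cap2Snd, p2w_usage10_0, p2w_usage10_1, p2w_usage10_2, p2w_usage10_3] <;> linarith [_hθ, _hθ1]

set_option maxHeartbeats 8000000 in
/-- TLC2 rows `(j′, 1, 2)` of `p2w`, `Fst`-branch: valid for `0 ≤ θ ≤ 1391 / 2921` (the kink `usage(2,10)/usage(1,10)`). [this work] -/
theorem tlc2_p2w_A_12 (j' : ℕ) (hj : j' < 17) (hi' : 2 ≤ j') (θ : ℝ) (_hθ0 : 0 ≤ θ) (_hθ : θ ≤ 1391 / 2921) :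
    p2wL 1 2 θ ≤ p2wR j' (cap2Fst (1 / 3) (187 / 30) j' 1) := by
  unfold p2wL p2wR
  interval_cases j' <;> norm_num [Finset.sum_range_succ, Finset.sum_Ico_eq_sum_range, p2w, cap2Fst, p2w_usage10_0, p2w_usage10_1, p2w_usage10_2, p2w_usage10_3] <;> linarith [_hθ0, _hθ]

set_option maxHeartbeats 8000000 in
/-- TLC2 rows `(j′, 1, 2)` of `p2w`, `Snd`-branch: valid for `1391 / 2921 ≤ θ ≤ 1`. [this work] -/
theorem tlc2_p2w_B_12 (j' : ℕ) (hj : j' < 17) (hi' : 2 ≤ j') (θ : ℝ) (_hθ : 1391 / 2921 ≤ θ) (_hθ1 : θ ≤ 1) :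
    p2wL 1 2 θ ≤ p2wR j' (fun h => cap2Snd (1 / 3) (187 / 30) j' 2 h θ) := by
  unfold p2wL p2wR
  interval_cases j' <;> norm_num [Finset.sum_range_succ, Finset.sum_Ico_eq_sum_range, p2w, cap2Snd, p2w_usage10_0, p2w_usage10_1, p2w_usage10_2, p2w_usage10_3] <;> linarith [_hθ, _hθ1]

set_option maxHeartbeats 8000000 in
/-- TLC2 rows `(j′, 1, 3)` of `p2w`, `Fst`-branch: valid for `0 ≤ θ ≤ 22 / 127` (the kink `usage(3,10)/usage(1,10)`). [this work] -/
theorem tlc2_p2w_A_13 (j' : ℕ) (hj : j' < 17) (hi' : 3 ≤ j') (θ : ℝ) (_hθ0 : 0 ≤ θ) (_hθ : θ ≤ 22 / 127) :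
    p2wL 1 3 θ ≤ p2wR j' (cap2Fst (1 / 3) (187 / 30) j' 1) := by
  unfold p2wL p2wR
  interval_cases j' <;> norm_num [Finset.sum_range_succ, Finset.sum_Ico_eq_sum_range, p2w, cap2Fst, p2w_usage10_0, p2w_usage10_1, p2w_usage10_2, p2w_usage10_3] <;> linarith [_hθ0, _hθ]

set_option maxHeartbeats 8000000 in
/-- TLC2 rows `(j′, 1, 3)` of `p2w`, `Snd`-branch: valid for `22 / 127 ≤ θ ≤ 1`. [this work] -/
theorem tlc2_p2w_B_13 (j' : ℕ) (hj : j' < 17) (hi' : 3 ≤ j') (θ : ℝ) (_hθ : 22 / 127 ≤ θ) (_hθ1 : θ ≤ 1) :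
    p2wL 1 3 θ ≤ p2wR j' (fun h => cap2Snd (1 / 3) (187 / 30) j' 3 h θ) := by
  unfold p2wL p2wR
  interval_cases j' <;> norm_num [Finset.sum_range_succ, Finset.sum_Ico_eq_sum_range, p2w, cap2Snd, p2w_usage10_0, p2w_usage10_1, p2w_usage10_2, p2w_usage10_3] <;> linarith [_hθ, _hθ1]

set_option maxHeartbeats 8000000 in
/-- TLC2 rows `(j′, 2, 3)` of `p2w`, `Fst`-branch: valid for `0 ≤ θ ≤ 506 / 1391` (the kink `usage(3,10)/usage(2,10)`). [this work] -/
theorem tlc2_p2w_A_23 (j' : ℕ) (hj : j' < 17) (hi' : 3 ≤ j') (θ : ℝ) (_hθ0 : 0 ≤ θ) (_hθ : θ ≤ 506 / 1391) :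
    p2wL 2 3 θ ≤ p2wR j' (cap2Fst (1 / 3) (187 / 30) j' 2) := by
  unfold p2wL p2wR
  interval_cases j' <;> norm_num [Finset.sum_range_succ, Finset.sum_Ico_eq_sum_range, p2w, cap2Fst, p2w_usage10_0, p2w_usage10_1, p2w_usage10_2, p2w_usage10_3] <;> linarith [_hθ0, _hθ]

set_option maxHeartbeats 8000000 in
/-- TLC2 rows `(j′, 2, 3)` of `p2w`, `Snd`-branch: valid for `506 / 1391 ≤ θ ≤ 1`. [this work] -/
theorem tlc2_p2w_B_23 (j' : ℕ) (hj : j' < 17) (hi' : 3 ≤ j') (θ : ℝ) (_hθ : 506 / 1391 ≤ θ) (_hθ1 : θ ≤ 1) :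
    p2wL 2 3 θ ≤ p2wR j' (fun h => cap2Snd (1 / 3) (187 / 30) j' 3 h θ) := by
  unfold p2wL p2wR
  interval_cases j' <;> norm_num [Finset.sum_range_succ, Finset.sum_Ico_eq_sum_range, p2w, cap2Snd, p2w_usage10_0, p2w_usage10_1, p2w_usage10_2, p2w_usage10_3] <;> linarith [_hθ, _hθ1]

/-- **`p2w` satisfies every two-threshold staircase row** (`TLC2` at floor `1/3`, target `187/30`): split `θ` at the kink and use the `Fst`- resp.
`Snd`-branch row (`cap2Fst/cap2Snd ≤ cap2`, `p2wR_mono`). [this work] -/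
theorem tlc2_p2w : TLC2 (1 / 3 : ℝ) (187 / 30) 17 p2w := by
  intro j' i'' i' θ hj hii hi' hlow hθ0 hθ1
  have hi3 : i' ≤ 3 := by
    by_contra hne
    have : (4 : ℝ) ≤ i' := by exact_mod_cast (by omega : 4 ≤ i')
    linarith
  change p2wL i'' i' θ ≤ p2wR j' (fun h => cap2 (1 / 3) (187 / 30) j' i'' i' h θ)
  have hA : ∀ a b : ℕ, ∀ h, cap2Fst (1 / 3 : ℝ) (187 / 30) j' a h ≤ cap2 (1 / 3) (187 / 30) j' a b h θ := fun a b h => cap2Fst_le_cap2 _ _ _ _ _ _ _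
  have hB : ∀ a b : ℕ, ∀ h, cap2Snd (1 / 3 : ℝ) (187 / 30) j' b h θ ≤ cap2 (1 / 3) (187 / 30) j' a b h θ := fun a b h => cap2Snd_le_cap2 _ _ _ _ _ _ _
  interval_cases i' <;> interval_cases i''
  · rcases le_total θ (14351 / 26741 : ℝ) with hle | hge
    · exact (tlc2_p2w_A_01 j' hj hi' θ hθ0 hle).trans (p2wR_mono j' _ _ (hA 0 1))
    · exact (tlc2_p2w_B_01 j' hj hi' θ hge hθ1).trans (p2wR_mono j' _ _ (hB 0 1))
  · rcases le_total θ (12091 / 47311 : ℝ) with hle | hge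
    · exact (tlc2_p2w_A_02 j' hj hi' θ hθ0 hle).trans (p2wR_mono j' _ _ (hA 0 2))
    · exact (tlc2_p2w_B_02 j' hj hi' θ hge hθ1).trans (p2wR_mono j' _ _ (hB 0 2))
  · rcases le_total θ (1391 / 2921 : ℝ) with hle | hge
    · exact (tlc2_p2w_A_12 j' hj hi' θ hθ0 hle).trans (p2wR_mono j' _ _ (hA 1 2))
    · exact (tlc2_p2w_B_12 j' hj hi' θ hge hθ1).trans (p2wR_mono j' _ _ (hB 1 2))
  · rcases le_total θ (226 / 2431 : ℝ) with hle | hge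
    · exact (tlc2_p2w_A_03 j' hj hi' θ hθ0 hle).trans (p2wR_mono j' _ _ (hA 0 3))
    · exact (tlc2_p2w_B_03 j' hj hi' θ hge hθ1).trans (p2wR_mono j' _ _ (hB 0 3))
  · rcases le_total θ (22 / 127 : ℝ) with hle | hge
    · exact (tlc2_p2w_A_13 j' hj hi' θ hθ0 hle).trans (p2wR_mono j' _ _ (hA 1 3))
    · exact (tlc2_p2w_B_13 j' hj hi' θ hge hθ1).trans (p2wR_mono j' _ _ (hB 1 3))
  · rcases le_total θ (506 / 1391 : ℝ) with hle | hge
    · exact (tlc2_p2w_A_23 j' hj hi' θ hθ0 hle).trans (p2wR_mono j' _ _ (hA 2 3))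
    · exact (tlc2_p2w_B_23 j' hj hi' θ hge hθ1).trans (p2wR_mono j' _ _ (hB 2 3))

/-! ### Not DEC at layer 10: the three-level staircase certificate -/

/-- the staircase price on the lows `0..3`: three levels `1/2, 1391/5842, 11/127` (`= usage(l,10)·β₁₀` for `l = 1,2,3`). [this work] -/
def p2wα (l : ℕ) : ℝ :=
  if l ≤ 1 then 1 / 2 else if l = 2 then 1391 / 5842 else if l = 3 then 11 / 127 else 0

/-- the absorber prices: the mid `10` at `143/254`, giants `h ≥ 11` at `1`, the massless mids `4..9` at `100`. [this work] -/
def p2wβ (h : ℕ) : ℝ :=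
  if h = 10 then 143 / 254 else if 11 ≤ h then 1 else 100

/-- `p2wβ ≥ 0`. [this work] -/
theorem p2wβ_nonneg (h : ℕ) : 0 ≤ p2wβ h := by
  simp only [p2wβ]; split_ifs <;> norm_num

/-- **dual feasibility of the certificate**: `α_l ≤ usage(l, h)·β_h` on every compatible pair of layer `10`. [this work] -/
theorem p2w_dual_feasible (l h : ℕ) (hl : l ≤ 10) (hlow : 2 * (l : ℝ) < 187 / 30) (hh : h ≤ 17)
    (hc : 10 + 1 ≤ h ∨ (187 / 30 : ℝ) < (l : ℝ) + h) : p2wα l ≤ usage (1 / 3 : ℝ) (187 / 30) 10 l h * p2wβ h := by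
  have hl3 : l ≤ 3 := by
    by_contra hne
    have : (4 : ℝ) ≤ l := by exact_mod_cast (by omega : 4 ≤ l)
    linarith
  have hαle : p2wα l ≤ 1 / 2 := by simp only [p2wα]; split_ifs <;> norm_num
  by_cases hg : 10 + 1 ≤ h
  · -- giants: usage 1/2, price 1
    have hb : p2wβ h = 1 := by simp only [p2wβ]; rw [if_neg (by omega), if_pos (by omega)]
    rw [p2w_usage_giant 10 l h hg, hb]; linarith
  · have hcomp : (187 / 30 : ℝ) < (l : ℝ) + h := by
      rcases hc with hc | hc
      · exact absurd hc hg
      · exact hc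
    have hh10 : h ≤ 10 := by omega
    by_cases h10 : h = 10
    · subst h10
      have hb : p2wβ 10 = 143 / 254 := by simp [p2wβ]
      rw [hb]
      interval_cases l <;> simp only [p2wα] <;> norm_num [p2w_usage10_0, p2w_usage10_1, p2w_usage10_2, p2w_usage10_3]
    · -- massless mids 4..9, price 100: usage ≥ (T − 2l)/(l + h − T) ≥ 7/173
      have hh9 : h ≤ 9 := by omega
      have hb : p2wβ h = 100 := by simp only [p2wβ]; rw [if_neg h10, if_neg (by omega)]
      rw [hb]
      have hu := heavy_le_usage (1 / 3 : ℝ) (187 / 30) 10 l h (by norm_num) (by norm_num) hh10 hlow hcomp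
      have h4 : 4 ≤ h := by
        by_contra hne
        have : (h : ℝ) ≤ 3 := by exact_mod_cast (by omega : h ≤ 3)
        have : (l : ℝ) ≤ 3 := by exact_mod_cast hl3
        linarith
      interval_cases l <;> interval_cases h <;> simp only [p2wα] <;> norm_num at hu ⊢ <;> linarith

/-- **`p2w` IS NOT DEC AT LAYER 10** (floor `1/3`): weak duality `dual_le_of_decAtT` with the certificate `(p2wα, p2wβ)` would give
`α·(lows) ≤ β·(absorbers)`, but `α·(lows) − β·(absorbers) = 72039/65172082 > 0`. [this work] -/
theorem not_decAt_p2w : ¬ DECAt (1 / 3 : ℝ) 10 17 p2w := by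
  intro hdec
  rw [decAt_iff_decAtT, p2w_mean] at hdec
  have key := dual_le_of_decAtT (1 / 3 : ℝ) (187 / 30) 10 17 p2w (by norm_num) (by norm_num) hdec p2wα p2wβ p2wβ_nonneg
    (fun l h hl hlow hh hc => p2w_dual_feasible l h hl hlow hh hc)
  simp only [Finset.sum_range_succ, Finset.sum_range_zero, p2w, p2wα, p2wβ] at key
  norm_num at key

/-- **DEC IS NOT OF DEPTH 2** (packaged): there are a floor `y < 1/2`, a probability law on `{0..M}` vanishing above `M`, top-affordable, with its
mean as target, that satisfies every depth-≤ 2 row (`TLB ∧ TLC ∧ TLC2`) and is not DEC at some layer `j < M`. [this work] -/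
theorem depthTwo_ne_dec : ∃ (y : ℝ) (M j : ℕ) (ν : ℕ → ℝ), 0 < y ∧ y < 1 / 2 ∧ j < M ∧
    (∀ h, 0 ≤ ν h) ∧ (∀ h, M < h → ν h = 0) ∧ (∑ h ∈ Finset.range (M + 1), ν h = 1) ∧
    y * (M : ℝ) ≤ (∑ h ∈ Finset.range (M + 1), (h : ℝ) * ν h) ∧
    TLB (y / (1 - y)) (∑ h ∈ Finset.range (M + 1), (h : ℝ) * ν h) M ν ∧
    TLC y (∑ h ∈ Finset.range (M + 1), (h : ℝ) * ν h) M ν ∧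
    TLC2 y (∑ h ∈ Finset.range (M + 1), (h : ℝ) * ν h) M ν ∧ ¬ DECAt y j M ν := by
  refine ⟨1 / 3, 17, 10, p2w, by norm_num, by norm_num, by norm_num, p2w_nonneg, p2w_zero_above, p2w_sum, p2w_TA, ?_, ?_, ?_, not_decAt_p2w⟩
  · rw [p2w_mean, show (1 / 3 : ℝ) / (1 - 1 / 3) = 1 / 2 by norm_num]; exact tlb_p2w
  · rw [p2w_mean]; exact tlc_p2w
  · rw [p2w_mean]; exact tlc2_p2w

end LawDec

end Quant

end Summit.CriticalPhenomena.PercolationContinuityZ3.Theorems
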